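/-
Copyright (c) 2026 the pub-hodgecm-mathlib formalisation cell (harness21).  Prover seat hodgecm-mathlib-K2Liu-p01 (g2): Track B «K2-LIT»,
#184♮ = hLiu418 = stmt-HodgeConjecture-24832, STEWARD of socket #41 `sig_K2LiuSiegelEisensteinContinuation`; LEAD F0P6-plan (g10) DEAL
2026-09-03T23:22:15Z «O41.5 Gindikin–Karpelevich for the Siegel parabolic»; REPORT-FIRST O41.5 220813e546421255 §3, file (4c).
-/
import Literature.NumberTheory.K2Lit.LocalDoublingSiegel                               -- ★ D7c: `LambdaLoc`, `siegelDeltaLoc`, `IsSiegelIntDecomp`, `lambdaLoc_*`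
import Literature.NumberTheory.K2Lit.LocalSiegelIntertwining                          -- ★ D10: `IsSphericalSection`, `.unique`
import Summits.HodgeConjecture.HodgeConjecture.Theorems.K2LiuLocalSiegelIwasawa       -- ★ (4b): `exists_isSiegelDelta_mul_mem_localInt`
import HarnessLib

/-!
# Crux `HLiu418`, road `K2_Liu`, socket #41, organ O41.5, file (4c): THE SPHERICAL SECTION `φ°_s = Λ_{s,v}` of `I_v(s, χ_v)` —
# it is spherical everywhere, and at a good place it is the UNIQUE spherical section (no junk value)

Cell `hodgecm-mathlib`, crux item hLiu418 = `stmt-HodgeConjecture-24832`; squad K2 ∕ K2Liu; prover K2Liu-p01 (g2), steward of #41.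
THEOREMS ONLY (no `def`, no instance, no notation, no named-fact hypothesis, no `sorry`); lane `--supports stmt-HodgeConjecture-24832`.

THE OBJECTS (all ★).  The K2_Liu CM frame: `L` CM, `H(L⁺_v) = U(hermD)(L⁺_v)` on `UnitaryGroup.localPi L c (n+n) (hermD L e dV hdV dW hdW) v`, its Siegel
parabolic ★ `siegelDeltaLoc` (= the GR91 local `IsSiegelDelta` at `T₀ = gramR`, `δ = imagUnit L`: ★ `mem_siegelDeltaLoc_iff_local`), `K_v = H(𝒪_v)` (★ `localInt`),
the unramified local Siegel section ★ `LambdaLoc χ v s` of ★ D7c `K2Lit/LocalDoublingSiegel` (`Λ_{s,v}(p k) = χ_v(det_Δ p)|det_Δ p|_v^{s+n/2}`, junk `0` off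
`P_Δ·K_v`), and the predicate ★ D10 `IsSphericalSection χv s φ` (Siegel section ∧ right-`K_v`-invariant ∧ `φ 1 = 1`).

WHAT IS PROVED.
* §1 `isSphericalSection_lambdaLoc` — for `χ` unramified above `v` (ANY finite `v`): `Λ_{s,v}` IS a spherical section of `I_v(s, χ_v)` (★ `lambdaLoc_siegel_mul`,
  `lambdaLoc_mul_localInt`, `lambdaLoc_one`; the junk branch is consistent with all three laws).
* §2 `exists_isSiegelIntDecomp` — at a GOOD place (`|2|_w = 1`, `gramR`, `gramR⁻¹` integral at every `w ∣ v`): every `h` HAS a decomposition `h = p k`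
  (★ (4b) `exists_isSiegelDelta_mul_mem_localInt` at `F = L⁺`, `E = L`, `T₀ = gramR`), so `Λ_{s,v}` never takes its junk value:
  `lambdaLoc_eq_localSiegelCharacter` (`Λ_{s,v}(h) = localSiegelCharacter χ_v s p` for ANY decomposition `h = p k`).
* §3 `IsSphericalSection.eq_lambdaLoc` — at a good place EVERY spherical section of `I_v(s, χ_v)` equals `Λ_{s,v}` (★ D10 `IsSphericalSection.unique` + §2);
  `existsUnique_isSphericalSection`.  This PINS the `φ°_s` of the Gindikin–Karpelevich identity O41.5 (`M_v(s)φ°_s = vol · (a_v/b_v)(s) · φ°_{−s}`) to the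
  tree's ★ `LambdaLoc`, the same vector the local doubling files (#28s–#33s) use.
HONEST LABEL.  Count-neutral helper; it retires nothing by itself: `HC_CM` is proved only modulo the 7 printed citations (2 remaining named inputs:
hLiu418 = `stmt-HodgeConjecture-24832`, h413 = `stmt-HodgeConjecture-24833`) until rung 0 closes.

## References
* [Casselman1980] W. Casselman, Compositio Math. 40 (1980): §3 (the spherical vector of an unramified principal series via `G = PK`).
* [Li1992] J.-S. Li, J. reine angew. Math. 428 (1992): §3 (the unramified Siegel section).
* [HarrisKudlaSweet1996] M. Harris, S. Kudla, W. J. Sweet, J. AMS 9 (1996): §1 (1.15), §6 (6.14).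
* [BruhatTits1972] F. Bruhat, J. Tits, Publ. IHÉS 41 (1972): (4.4.3).
-/

set_option autoImplicit false
set_option linter.dupNamespace false -- the mandated namespace repeats `HodgeConjecture.HodgeConjecture`

noncomputable section

open NumberField IsDedekindDomain Matrix
open Literature.NumberTheory.Automorphic Literature.NumberTheory.Automorphic.UnitaryGroup
open Literature.NumberTheory.GaloisRepresentations
open Literature.NumberTheory.GelbartRogawski1991 Literature.NumberTheory.GelbartRogawski1991.GRConstruction
open Literature.NumberTheory.GelbartRogawski1991.UnitaryDualPair
open Literature.NumberTheory.K2Lit.SiegelDoubled Literature.NumberTheory.K2Lit.LocalSiegelDoubled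

namespace Summit.HodgeConjecture.HodgeConjecture.Cruxes.HLiu418.K2LiuSphericalSectionLambdaLoc

variable (L : Type) [Field L] [NumberField L] [IsCMField L]
variable {N M n : ℕ} (e : Fin N × Fin M ≃ Fin n)
  (dV : Fin N → L) (hdV : ∀ i, IsCMField.complexConj L (dV i) = dV i)
  (dW : Fin M → L) (hdW : ∀ i, IsCMField.complexConj L (dW i) = dW i)
  (v : HeightOneSpectrum (𝓞 (Fp L)))

/-! ## §1 `Λ_{s,v}` is a spherical section (every finite `v`, `χ` unramified above `v`) -/

/-- **`Λ_{s,v}` is a spherical section of `I_v(s, χ_v)`** (★ D10 `IsSphericalSection` at the GR91 local package `δ = imagUnit L`, `T₀ = gramR`):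
Siegel law ★ `lambdaLoc_mem_localDegPS`, right `K_v`-invariance ★ `lambdaLoc_mul_localInt`, `Λ(1) = 1` ★ `lambdaLoc_one`.
[cite: Li1992, §3] [cite: Casselman1980, §3] [cite: HarrisKudlaSweet1996, §6 (6.14)] -/
theorem isSphericalSection_lambdaLoc (χ : HeckeCharacter L) (s : ℂ) (hχ : ∀ w : UnitaryGroup.PlacesOver L v, χ.IsUnramifiedAt w.1) :
    haveI : Algebra.IsQuadraticExtension (Fp L) L := IsCMField.isQuadraticExtension L
    IsSphericalSection (Fp L) L (IsCMField.complexConj L) (complexConj_imagUnit L) (imagUnit_ne_zero L) (imagUnit_mul_self L) v n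
      (gramR_isSymm L e dV hdV dW hdW) (hermD_eq_map_gramD L e dV hdV dW hdW) (fun w => χ.localComponent w.1) s
      (LambdaLoc L e dV hdV dW hdW v χ s) := by
  haveI : Algebra.IsQuadraticExtension (Fp L) L := IsCMField.isQuadraticExtension L
  exact ⟨(lambdaLoc_mem_localDegPS L e dV hdV dW hdW v χ s hχ).1, fun k hk h => lambdaLoc_mul_localInt L e dV hdV dW hdW v χ s hχ h hk,
    lambdaLoc_one L e dV hdV dW hdW v χ s hχ⟩

/-! ## §2 At a good place every `h` decomposes: `Λ_{s,v}` has no junk value -/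

variable (hdV0 : ∀ i, dV i ≠ 0) (hdW0 : ∀ i, dW i ≠ 0)

include hdV0 hdW0 in
/-- **At a good place every `h ∈ H(L⁺_v)` is `p · k`, `p ∈ P_Δ(L⁺_v)`, `k ∈ K_v`** (★ (4b) `exists_isSiegelDelta_mul_mem_localInt` on the K2_Liu frame,
`T₀ = gramR`, read in ★ D7c's `IsSiegelIntDecomp` currency). [cite: BruhatTits1972, (4.4.3)] [cite: Casselman1980, §3] -/
theorem exists_isSiegelIntDecomp
    (h2 : ∀ w : UnitaryGroup.PlacesOver L v, ValuativeRel.valuation (w.1.adicCompletion L) (2 : w.1.adicCompletion L) = 1)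
    (hT : ∀ (w : UnitaryGroup.PlacesOver L v) (i j : Fin n), ValuativeRel.valuation (w.1.adicCompletion L)
      (algebraMap L (w.1.adicCompletion L) (algebraMap (Fp L) L (gramR L e dV hdV dW hdW i j))) ≤ 1)
    (hTinv : ∀ (w : UnitaryGroup.PlacesOver L v) (i j : Fin n), ValuativeRel.valuation (w.1.adicCompletion L)
      (algebraMap L (w.1.adicCompletion L) (algebraMap (Fp L) L ((gramR L e dV hdV dW hdW)⁻¹ i j))) ≤ 1)
    (h : UnitaryGroup.localPi L (IsCMField.complexConj L) (n + n) (hermD L e dV hdV dW hdW) v) :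
    ∃ pk, IsSiegelIntDecomp L e dV hdV dW hdW v h pk := by
  haveI : Algebra.IsQuadraticExtension (Fp L) L := IsCMField.isQuadraticExtension L
  obtain ⟨p, k, hp, hk, hpk⟩ := K2LiuLocalSiegelIwasawa.exists_isSiegelDelta_mul_mem_localInt (Fp L) L (IsCMField.complexConj L)
    (complexConj_imagUnit L) (imagUnit_ne_zero L) (imagUnit_mul_self L) v n (gramR_isSymm L e dV hdV dW hdW) (hermD_eq_map_gramD L e dV hdV dW hdW)
    (isUnit_det_gram (Fp L) e (isUnit_det_realDiagonal L dV hdV hdV0) (isUnit_det_realDiagonal L dW hdW hdW0)) h2 hT hTinv h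
  exact ⟨(p, k), (mem_siegelDeltaLoc_iff_local L e dV hdV dW hdW v p).2 hp, hk, hpk⟩

/-- **No junk on `P_Δ·K_v`** (all of `H(L⁺_v)` at a good place, `exists_isSiegelIntDecomp`): for `χ` unramified above `v` and ANY decomposition `h = p k`,
`Λ_{s,v}(h) = χ_v(det_Δ p)|det_Δ p|_v^{s+n/2}`
(★ D1 `localSiegelCharacter`). [cite: Li1992, §3] [cite: HarrisKudlaSweet1996, §1 (1.15)] -/
theorem lambdaLoc_eq_localSiegelCharacter (χ : HeckeCharacter L) (s : ℂ) (hχ : ∀ w : UnitaryGroup.PlacesOver L v, χ.IsUnramifiedAt w.1)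
    {p k : UnitaryGroup.localPi L (IsCMField.complexConj L) (n + n) (hermD L e dV hdV dW hdW) v}
    (hp : p ∈ siegelDeltaLoc L e dV hdV dW hdW v) (hk : k ∈ UnitaryGroup.localInt L (IsCMField.complexConj L) (n + n) (hermD L e dV hdV dW hdW) v) :
    haveI : Algebra.IsQuadraticExtension (Fp L) L := IsCMField.isQuadraticExtension L
    LambdaLoc L e dV hdV dW hdW v χ s (p * k) =
      localSiegelCharacter (Fp L) L (IsCMField.complexConj L) v n (fun w => χ.localComponent w.1) s p := by
  haveI : Algebra.IsQuadraticExtension (Fp L) L := IsCMField.isQuadraticExtension L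
  rw [lambdaLoc_mul_eq L e dV hdV dW hdW v χ s hχ hp hk, siegelCharLoc_eq_localSiegelCharacter_of_mem L e dV hdV dW hdW v χ s hp]

/-! ## §3 At a good place the spherical section is unique: `φ = Λ_{s,v}` -/

include hdV0 hdW0 in
/-- **UNIQUENESS: at a good place every spherical section of `I_v(s, χ_v)` is `Λ_{s,v}`** (★ D10 `IsSphericalSection.unique`, the Iwasawa hypothesis
discharged by ★ (4b)). [cite: Casselman1980, §3] [cite: Li1992, §3] -/
theorem eq_lambdaLoc_of_isSphericalSection (χ : HeckeCharacter L) (s : ℂ) (hχ : ∀ w : UnitaryGroup.PlacesOver L v, χ.IsUnramifiedAt w.1)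
    (h2 : ∀ w : UnitaryGroup.PlacesOver L v, ValuativeRel.valuation (w.1.adicCompletion L) (2 : w.1.adicCompletion L) = 1)
    (hT : ∀ (w : UnitaryGroup.PlacesOver L v) (i j : Fin n), ValuativeRel.valuation (w.1.adicCompletion L)
      (algebraMap L (w.1.adicCompletion L) (algebraMap (Fp L) L (gramR L e dV hdV dW hdW i j))) ≤ 1)
    (hTinv : ∀ (w : UnitaryGroup.PlacesOver L v) (i j : Fin n), ValuativeRel.valuation (w.1.adicCompletion L)
      (algebraMap L (w.1.adicCompletion L) (algebraMap (Fp L) L ((gramR L e dV hdV dW hdW)⁻¹ i j))) ≤ 1)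
    {φ : UnitaryGroup.localPi L (IsCMField.complexConj L) (n + n) (hermD L e dV hdV dW hdW) v → ℂ}
    (hφ : haveI : Algebra.IsQuadraticExtension (Fp L) L := IsCMField.isQuadraticExtension L
      IsSphericalSection (Fp L) L (IsCMField.complexConj L) (complexConj_imagUnit L) (imagUnit_ne_zero L) (imagUnit_mul_self L) v n
        (gramR_isSymm L e dV hdV dW hdW) (hermD_eq_map_gramD L e dV hdV dW hdW) (fun w => χ.localComponent w.1) s φ) :
    φ = LambdaLoc L e dV hdV dW hdW v χ s := by
  haveI : Algebra.IsQuadraticExtension (Fp L) L := IsCMField.isQuadraticExtension L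
  refine IsSphericalSection.unique (fun h => ?_) hφ (isSphericalSection_lambdaLoc L e dV hdV dW hdW v χ s hχ)
  obtain ⟨p, k, hp, hk, hpk⟩ := K2LiuLocalSiegelIwasawa.exists_isSiegelDelta_mul_mem_localInt (Fp L) L (IsCMField.complexConj L)
    (complexConj_imagUnit L) (imagUnit_ne_zero L) (imagUnit_mul_self L) v n (gramR_isSymm L e dV hdV dW hdW) (hermD_eq_map_gramD L e dV hdV dW hdW)
    (isUnit_det_gram (Fp L) e (isUnit_det_realDiagonal L dV hdV hdV0) (isUnit_det_realDiagonal L dW hdW hdW0)) h2 hT hTinv h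
  exact ⟨p, k, hp, hk, hpk⟩

include hdV0 hdW0 in
/-- **EXISTENCE AND UNIQUENESS of the spherical vector of `I_v(s, χ_v)` at a good place, `χ` unramified above `v`** — and it is `Λ_{s,v}`.
[cite: Casselman1980, §3] [cite: Li1992, §3] [cite: HarrisKudlaSweet1996, §6 (6.14)] -/
theorem existsUnique_isSphericalSection (χ : HeckeCharacter L) (s : ℂ) (hχ : ∀ w : UnitaryGroup.PlacesOver L v, χ.IsUnramifiedAt w.1)
    (h2 : ∀ w : UnitaryGroup.PlacesOver L v, ValuativeRel.valuation (w.1.adicCompletion L) (2 : w.1.adicCompletion L) = 1)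
    (hT : ∀ (w : UnitaryGroup.PlacesOver L v) (i j : Fin n), ValuativeRel.valuation (w.1.adicCompletion L)
      (algebraMap L (w.1.adicCompletion L) (algebraMap (Fp L) L (gramR L e dV hdV dW hdW i j))) ≤ 1)
    (hTinv : ∀ (w : UnitaryGroup.PlacesOver L v) (i j : Fin n), ValuativeRel.valuation (w.1.adicCompletion L)
      (algebraMap L (w.1.adicCompletion L) (algebraMap (Fp L) L ((gramR L e dV hdV dW hdW)⁻¹ i j))) ≤ 1) :
    ∃! φ : UnitaryGroup.localPi L (IsCMField.complexConj L) (n + n) (hermD L e dV hdV dW hdW) v → ℂ,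
      haveI : Algebra.IsQuadraticExtension (Fp L) L := IsCMField.isQuadraticExtension L
      IsSphericalSection (Fp L) L (IsCMField.complexConj L) (complexConj_imagUnit L) (imagUnit_ne_zero L) (imagUnit_mul_self L) v n
        (gramR_isSymm L e dV hdV dW hdW) (hermD_eq_map_gramD L e dV hdV dW hdW) (fun w => χ.localComponent w.1) s φ :=
  ⟨LambdaLoc L e dV hdV dW hdW v χ s, isSphericalSection_lambdaLoc L e dV hdV dW hdW v χ s hχ,
    fun _ hφ => eq_lambdaLoc_of_isSphericalSection L e dV hdV dW hdW v hdV0 hdW0 χ s hχ h2 hT hTinv hφ⟩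

end Summit.HodgeConjecture.HodgeConjecture.Cruxes.HLiu418.K2LiuSphericalSectionLambdaLoc

end
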